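import Summits.QuantumFields.BalabanUV.T4Continuum.Spine.NE5.TwoRunTorusNE5AllL

/-!
# Spine/NE5/TwoRunTorusNE5All8 — the Lemma-3 witness of the minimal END of row NE5 at EVERY block size `L ≥ 8`
# (cell `pub-balaban-gaps`, seat `ne5` gen 15; located remark (x18′): the threshold of (x18) made EXPLICIT)

WHY.  T50 `TwoRunTorusNE5AllL.lemma3_witness_allL` and T51 `TwoRunTorusNE5FinalL.ne5_end_final_allL` quantify the END
of row NE5 as `∃ L₀ ≥ 8, ∀ L ≥ L₀, ∃ c, c.L = L ∧ …` — print's own shape ([I] = CMP 109 p. 251, verbatim *"We take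
L_μ = L^m, where L is an odd, positive integer > 11"*: the block size is the producer's, fixed first) — but the
threshold `L₀` is the block size of r10's Lemma-3 record, which `B13Lemma3TorusNonvacuity.numerics_nonvacuous_pos`
hides behind its `∃ c`: only `8 ≤ L₀` is exported, so a producer at a SPECIFIC printed `L` (13, 15, …) could not check
`L₀ ≤ L` — located remark (x18′) of `HOME/ne/NE5.md` (the residue of (x18)).  Part 6 of r10's file now states the
41 conjuncts AT THE NAMED record `consts` (`numerics_nonvacuous_pos_consts`, bond-cube side `1`, rate `aw`,
`a₂ = a₂′ = 1`, `a₅ = ½`, `Aabs = 1`, `Bc = 1∕64`) with `consts_L : consts.L = 8`.  THIS FILE: §1 `allM_of_witness` —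
T45's monotone re-run of the rate (`a ↦ a + 80 log M`: the (2.31) count `8M⁴e^{−a∕10}` is the only conjunct that sees
the bond-cube side; every other occurrence of `a` is antitone, `TwoRunTorusNE5Uniform.A237_antitone`) stated for ANY
record meeting the 41 conjuncts at ONE bond-cube side `M₁ ≥ 1` and one rate `a`; §2 `lemma3_witness_all8` — Part 6 →
§1 → T50 `lemma3_witness_transfer` (field surgery `c.L ↦ L ≥ c.L`): `∃ a₂ a₂′ a₅ Aabs Bc, ∀ L ≥ 8, ∃ c, c.L = L ∧
∀ M ≥ 1, ∃ a, (41 conjuncts VERBATIM)` — the threshold is the NUMBER 8, nothing hidden; print's regime {13, 15, 17, …}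
is covered.  `TwoRunTorusNE5Final8` re-states the END (T51) with `∀ L ≥ 8` outermost.  The real letter `c.M` (R24)
and the bond-cube side stay separate letters, as in r10's witness, T45 and T50 ((x15″)).

HONEST FRAMING.  Witness ∕ quantifier bookkeeping over landed shapes (no new inequality is proved here: §1 is T45's
argument with the record a parameter, §2 is composition); it certifies only that the typed inequality list is
CONSISTENT at every `L ≥ 8` and every `M ≥ 1`, nothing about the size of Bałaban's constants; nothing of Bałaban's
is constructed or asserted beyond print.  NE5 NOT PRINTED ∕ NOT PROVED; leaves 0∕12; (D4) 0∕1; spine 0∕9.  Rung (B)+1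
on a FIXED finite T⁴ — NOT continuum ∕ infinite volume ∕ mass gap ∕ Clay; continuum YM on T⁴ ⇐ BetaPertH ∧ nine spine
estimates.  0 sorry, 0 `def`.  Sources: [II] = T. Bałaban, CMP **116** (1988) [Balaban1988RG2Cluster] (2.18) p. 16,
(2.31) p. 18, p. 20 (before (2.37)), p. 21 (closing paragraph); [I] = CMP **109** (1987) [Balaban1987RG1] p. 251.
Nothing here is a claim about the Yang–Mills mass gap.
-/

noncomputable section

namespace Summit.QuantumFields.BalabanUV.T4Continuum.Spine.NE5.TwoRunTorusNE5All8

open Literature.MathematicalPhysics.QuantumFieldTheory.Balaban1983to89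
open Literature.MathematicalPhysics.QuantumFieldTheory.Balaban1983to89.B13Bound143 (invTau)
open Literature.MathematicalPhysics.QuantumFieldTheory.Balaban1983to89.B12TreeDecay (kappa₀ K₀ K₀_pos)
open Literature.MathematicalPhysics.QuantumFieldTheory.Balaban1983to89.B13Lemma3TorusNonvacuity
  (consts numerics_nonvacuous_pos_consts consts_L)
open Summit.QuantumFields.BalabanUV.T4Continuum.Spine.NE5.TwoRunTorusNE5Uniform (A237_antitone exp_neg_eight_log)
open Summit.QuantumFields.BalabanUV.T4Continuum.Spine.NE5.TwoRunTorusNE5AllL (lemma3_witness_transfer)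

/-! ## §1. T45's re-run of the rate, for ANY record -/

/-- **ALL BOND-CUBE SIDES FROM ONE.**  If a record `c` satisfies the 41 conjuncts of r10's `numerics_nonvacuous_pos`
(R15–R18, R20, R22–R24, the smallness of (2.29) ∕ (2.31), the O(1) of (2.37) ∕ (2.38) ∕ (2.41), the ½E₀ bookkeeping,
`a₅ > 0`, `κ₁ ≥ 1`, the (2.18) clause) at ONE bond-cube side `M₁ ≥ 1` and one rate `a`, then it satisfies them at
EVERY `M ≥ 1` with the same letters `a₂, a₂′, a₅, Aabs, Bc` and the rate `a + 80 log M`: the (2.31) count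
`8M⁴e^{−a∕10} ≤ a∕20` (p. 18) is the only conjunct that sees `M`, and `8M⁴e^{−(a + 80 log M)∕10} = 8e^{−a∕10}M⁻⁴ ≤
8M₁⁴e^{−a∕10}`; every other occurrence of the rate is monotone (R16, R17, the absorption `64e^{−a∕20} ≤ δκ`) or
antitone through the (2.37) letter `K₀·exp(64e^{−a∕20})` (`A237_antitone`: R18, the O(1) of C₃).  T45
`TwoRunTorusNE5Uniform.lemma3_witness_allM` is this with `c` r10's record; the proof is T45's, the record a parameter.
[cite: Balaban1988RG2Cluster, (2.31) p.18, p.20 (before (2.37)), p.21 (closing paragraph: "The assumptions allow finally us to fix all the constants")] -/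
theorem allM_of_witness (c : B13.Consts) {M₁ : ℕ} {a a₂ a₂' a₅ Aabs Bc : ℝ}
    (h : 8 ≤ c.L ∧ 0 < M₁ ∧ 0 < c.ε₁ ∧ 0 < c.α₆ ∧ 0 ≤ c.eps2 ∧ 0 ≤ c.δ ∧ 0 ≤ 1 - 7 * c.δ ∧ 0 ≤ c.κ ∧ 0 ≤ a ∧
      c.R15 ∧ 18 * ((1 - 4 * c.δ) * c.κ) ≤ a / 20 ∧ 4 * c.κ ≤ a / 20 ∧ Real.exp (-(a / 20)) ≤ c.eps2 ∧
      2 * (4 : ℝ) * (M₁ : ℝ) ^ 4 * Real.exp (-(a / 10)) ≤ a / 20 ∧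
      0 ≤ a₂ ∧ kappa₀ 64 8 + a₂ ≤ c.δ * c.κ ∧ c.α₆ * Real.exp a₂ * K₀ 64 8 * 64 ≤ a₂ ∧
      Real.exp (-(a / 20)) * 64 ≤ c.δ * c.κ ∧
      B13Step237.R18half c (K₀ 64 8 * Real.exp (Real.exp (-(a / 20)) * 64)) ∧
      B13Step237.R18sharp c (K₀ 64 8 * Real.exp (Real.exp (-(a / 20)) * 64)) ((c.L : ℝ) / 2) ∧
      0 ≤ a₂' ∧ kappa₀ 64 8 + a₂' ≤ c.δ * ((c.L : ℝ) / 2) * c.κ ∧ c.α₆ * Real.exp a₂' * K₀ 64 8 * 64 ≤ a₂' ∧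
      18 * ((1 - 7 * c.δ) * ((c.L : ℝ) / 2) * c.κ) ≤ (c.κ₁ - 1) / 2 ∧
      0 ≤ a₅ ∧ a₅ + Real.exp (-((c.κ₁ - 1) / 2)) ≤ Aabs ∧ Aabs * 64 ≤ c.δ * ((c.L : ℝ) / 2) * c.κ ∧
      B13Step237.bracketF c (K₀ 64 8 * Real.exp (Real.exp (-(a / 20)) * 64)) / c.α₆ * Real.exp (Aabs * 64) ≤
        c.C3act * c.ε₁ ∧
      0 ≤ c.C3act * c.ε₁ ∧ c.κ + 2 * (64 * Real.log 162) + 2 ≤ (1 - 8 * c.δ) * ((c.L : ℝ) / 2) * c.κ ∧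
      c.C3act * c.ε₁ * Real.exp (5 * c.κ + 1) * K₀ 64 8 * 9 * 64 ≤ 1 ∧
      Real.exp 1 * 9 * 64 * K₀ 64 8 ^ 2 ≤ c.A₂ ∧ c.R22 ∧ c.R23 ∧ c.R24sharp ∧ 0 ≤ c.E₀ ∧
      0 ≤ Bc ∧ Bc * 64 ≤ c.E₀ / 2 ∧
      0 < a₅ ∧ 1 ≤ c.κ₁ ∧
      (∀ d : ℝ, 0 ≤ d → 0 < invTau c d ∧ invTau c d ≤ 1 / 2)) :
    ∀ M : ℕ, 0 < M → ∃ a' : ℝ,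
      8 ≤ c.L ∧ 0 < M ∧ 0 < c.ε₁ ∧ 0 < c.α₆ ∧ 0 ≤ c.eps2 ∧ 0 ≤ c.δ ∧ 0 ≤ 1 - 7 * c.δ ∧ 0 ≤ c.κ ∧ 0 ≤ a' ∧
      c.R15 ∧ 18 * ((1 - 4 * c.δ) * c.κ) ≤ a' / 20 ∧ 4 * c.κ ≤ a' / 20 ∧ Real.exp (-(a' / 20)) ≤ c.eps2 ∧
      2 * (4 : ℝ) * (M : ℝ) ^ 4 * Real.exp (-(a' / 10)) ≤ a' / 20 ∧
      0 ≤ a₂ ∧ kappa₀ 64 8 + a₂ ≤ c.δ * c.κ ∧ c.α₆ * Real.exp a₂ * K₀ 64 8 * 64 ≤ a₂ ∧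
      Real.exp (-(a' / 20)) * 64 ≤ c.δ * c.κ ∧
      B13Step237.R18half c (K₀ 64 8 * Real.exp (Real.exp (-(a' / 20)) * 64)) ∧
      B13Step237.R18sharp c (K₀ 64 8 * Real.exp (Real.exp (-(a' / 20)) * 64)) ((c.L : ℝ) / 2) ∧
      0 ≤ a₂' ∧ kappa₀ 64 8 + a₂' ≤ c.δ * ((c.L : ℝ) / 2) * c.κ ∧ c.α₆ * Real.exp a₂' * K₀ 64 8 * 64 ≤ a₂' ∧
      18 * ((1 - 7 * c.δ) * ((c.L : ℝ) / 2) * c.κ) ≤ (c.κ₁ - 1) / 2 ∧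
      0 ≤ a₅ ∧ a₅ + Real.exp (-((c.κ₁ - 1) / 2)) ≤ Aabs ∧ Aabs * 64 ≤ c.δ * ((c.L : ℝ) / 2) * c.κ ∧
      B13Step237.bracketF c (K₀ 64 8 * Real.exp (Real.exp (-(a' / 20)) * 64)) / c.α₆ * Real.exp (Aabs * 64) ≤
        c.C3act * c.ε₁ ∧
      0 ≤ c.C3act * c.ε₁ ∧ c.κ + 2 * (64 * Real.log 162) + 2 ≤ (1 - 8 * c.δ) * ((c.L : ℝ) / 2) * c.κ ∧
      c.C3act * c.ε₁ * Real.exp (5 * c.κ + 1) * K₀ 64 8 * 9 * 64 ≤ 1 ∧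
      Real.exp 1 * 9 * 64 * K₀ 64 8 ^ 2 ≤ c.A₂ ∧ c.R22 ∧ c.R23 ∧ c.R24sharp ∧ 0 ≤ c.E₀ ∧
      0 ≤ Bc ∧ Bc * 64 ≤ c.E₀ / 2 ∧
      0 < a₅ ∧ 1 ≤ c.κ₁ ∧
      (∀ d : ℝ, 0 ≤ d → 0 < invTau c d ∧ invTau c d ≤ 1 / 2) := by
  obtain ⟨hL, hM₁, hε₁, hα₆, hε₀, hδ, hδ7, hκc, ha, hR15, hR16, hR16', hR17, h231,
    ha₂, hκ229, hsm229, habsk, h18half, h18, ha₂', hκ229', hsm229', hR20, ha₅0, habs, hAc, hC3, hAct, hlarge,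
    hsmall41, hA₂, hR22, hR23, hR24, hE₀, hBc, hBcE, ha₅, hκ₁, hτ⟩ := h
  intro M hM
  -- the re-run rate
  have hMr : (1 : ℝ) ≤ (M : ℝ) := by exact_mod_cast hM
  have hlog : 0 ≤ Real.log (M : ℝ) := Real.log_nonneg hMr
  have haa : a ≤ a + 80 * Real.log (M : ℝ) := by linarith
  have ha' : 0 ≤ a + 80 * Real.log (M : ℝ) := by linarith
  have h20 : a / 20 ≤ (a + 80 * Real.log (M : ℝ)) / 20 := by linarith
  have hexp : Real.exp (-((a + 80 * Real.log (M : ℝ)) / 20)) ≤ Real.exp (-(a / 20)) := by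
    rw [Real.exp_le_exp]; linarith
  -- the (2.37) letter at the two rates
  have hA := A237_antitone haa
  have hL2 : 0 ≤ ((c.L : ℝ) + 2) ^ 4 := by positivity
  have hmem : B13Step237.memberF c (K₀ 64 8 * Real.exp (Real.exp (-((a + 80 * Real.log (M : ℝ)) / 20)) * 64)) ≤
      B13Step237.memberF c (K₀ 64 8 * Real.exp (Real.exp (-(a / 20)) * 64)) := by
    unfold B13Step237.memberF
    exact mul_le_mul_of_nonneg_right (mul_le_mul_of_nonneg_left hA hL2) hε₀
  have hbr : B13Step237.bracketF c (K₀ 64 8 * Real.exp (Real.exp (-((a + 80 * Real.log (M : ℝ)) / 20)) * 64)) ≤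
      B13Step237.bracketF c (K₀ 64 8 * Real.exp (Real.exp (-(a / 20)) * 64)) := by
    unfold B13Step237.bracketF
    linarith
  refine ⟨a + 80 * Real.log (M : ℝ), hL, hM, hε₁, hα₆, hε₀, hδ, hδ7, hκc, ha', hR15,
    hR16.trans h20, hR16'.trans h20, hexp.trans hR17, ?_, ha₂, hκ229, hsm229, ?_, ?_, ?_, ha₂', hκ229', hsm229', hR20,
    ha₅0, habs, hAc, ?_, hAct, hlarge, hsmall41, hA₂, hR22, hR23, hR24, hE₀, hBc, hBcE, ha₅, hκ₁, hτ⟩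
  · -- the (2.31) count: `8 M⁴ e^{−(a + 80 log M)∕10} = 8 e^{−a∕10} M⁻⁴ ≤ 8 M₁⁴ e^{−a∕10} ≤ a∕20`
    have hM' : (0 : ℝ) < (M : ℝ) := Nat.cast_pos.2 hM
    have hM₁r : (1 : ℝ) ≤ (M₁ : ℝ) := by exact_mod_cast hM₁
    have hsplit : Real.exp (-((a + 80 * Real.log (M : ℝ)) / 10)) =
        Real.exp (-(a / 10)) * ((M : ℝ) ^ 8)⁻¹ := by
      rw [← exp_neg_eight_log hM, ← Real.exp_add]
      congr 1
      ring
    rw [hsplit]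
    have hM4 : (1 : ℝ) ≤ (M : ℝ) ^ 4 := one_le_pow₀ hMr
    have hM8 : (M : ℝ) ^ 4 * ((M : ℝ) ^ 8)⁻¹ ≤ 1 := by
      rw [show (M : ℝ) ^ 8 = (M : ℝ) ^ 4 * (M : ℝ) ^ 4 by ring, mul_inv, ← mul_assoc,
        mul_inv_cancel₀ (pow_pos hM' 4).ne', one_mul]
      exact inv_le_one_of_one_le₀ hM4
    have hM₁4 : (1 : ℝ) ≤ (M₁ : ℝ) ^ 4 := one_le_pow₀ hM₁r
    calc 2 * (4 : ℝ) * (M : ℝ) ^ 4 * (Real.exp (-(a / 10)) * ((M : ℝ) ^ 8)⁻¹)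
        = 2 * 4 * Real.exp (-(a / 10)) * ((M : ℝ) ^ 4 * ((M : ℝ) ^ 8)⁻¹) := by ring
      _ ≤ 2 * 4 * Real.exp (-(a / 10)) * 1 := mul_le_mul_of_nonneg_left hM8 (by positivity)
      _ ≤ 2 * 4 * Real.exp (-(a / 10)) * (M₁ : ℝ) ^ 4 := mul_le_mul_of_nonneg_left hM₁4 (by positivity)
      _ = 2 * 4 * (M₁ : ℝ) ^ 4 * Real.exp (-(a / 10)) := by ring
      _ ≤ a / 20 := h231
      _ ≤ (a + 80 * Real.log (M : ℝ)) / 20 := h20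
  · -- the absorption `64 e^{−a∕20} ≤ δκ`
    exact (mul_le_mul_of_nonneg_right hexp (by norm_num)).trans habsk
  · -- R18 ((L+2)⁴O(1)ε₂ ≤ ½): monotone in the (2.37) letter
    unfold B13Step237.R18half at h18half ⊢
    exact hmem.trans h18half
  · -- R18 sharp form: monotone in the (2.37) letter
    unfold B13Step237.R18sharp at h18 ⊢
    exact (mul_le_mul_of_nonneg_right hbr (Real.exp_pos _).le).trans h18
  · -- the O(1) of C₃: monotone in the (2.37) letter (`α₆ > 0`)
    exact (mul_le_mul_of_nonneg_right (div_le_div_of_nonneg_right hbr hα₆.le) (Real.exp_pos _).le).trans hC3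

/-! ## §2. One record per block size `L ≥ 8` -/

/-- **THE LEMMA-3 WITNESS AT EVERY BLOCK SIZE `L ≥ 8`, SERVING EVERY BOND-CUBE SIDE — threshold explicit.**  There are
letters `a₂, a₂′, a₅, Aabs, Bc` (namely `1, 1, ½, 1, 1∕64`) such that for EVERY `L ≥ 8` ONE record `c` with `c.L = L`
satisfies, for every `M ≥ 1` at an `M`-dependent rate, the 41 conjuncts of `numerics_nonvacuous_pos` VERBATIM: r10's
NAMED record (`numerics_nonvacuous_pos_consts`, `consts_L : consts.L = 8`) → §1 → T50 `lemma3_witness_transfer`.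
T50's `lemma3_witness_allL` is the same with the threshold hidden (`∃ L₀ ≥ 8`).  Print's shape: the block size is the
producer's, fixed first ([I] p. 251 *"L is an odd, positive integer > 11"* — all of 13, 15, 17, … are served), the
constants are fixed after it (p. 21 *"The assumptions allow finally us to fix all the constants"*).  Consistency of
the typed list, not the size of Bałaban's constants.
[cite: Balaban1987RG1, p.251; Balaban1988RG2Cluster, p.21 (closing paragraph), (2.31) p.18, (2.18) p.16] -/
theorem lemma3_witness_all8 :
    ∃ (a₂ a₂' a₅ Aabs Bc : ℝ), ∀ L : ℕ, 8 ≤ L → ∃ c : B13.Consts, c.L = L ∧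
      ∀ M : ℕ, 0 < M → ∃ a : ℝ,
      8 ≤ c.L ∧ 0 < M ∧ 0 < c.ε₁ ∧ 0 < c.α₆ ∧ 0 ≤ c.eps2 ∧ 0 ≤ c.δ ∧ 0 ≤ 1 - 7 * c.δ ∧ 0 ≤ c.κ ∧ 0 ≤ a ∧
      c.R15 ∧ 18 * ((1 - 4 * c.δ) * c.κ) ≤ a / 20 ∧ 4 * c.κ ≤ a / 20 ∧ Real.exp (-(a / 20)) ≤ c.eps2 ∧
      2 * (4 : ℝ) * (M : ℝ) ^ 4 * Real.exp (-(a / 10)) ≤ a / 20 ∧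
      0 ≤ a₂ ∧ kappa₀ 64 8 + a₂ ≤ c.δ * c.κ ∧ c.α₆ * Real.exp a₂ * K₀ 64 8 * 64 ≤ a₂ ∧
      Real.exp (-(a / 20)) * 64 ≤ c.δ * c.κ ∧
      B13Step237.R18half c (K₀ 64 8 * Real.exp (Real.exp (-(a / 20)) * 64)) ∧
      B13Step237.R18sharp c (K₀ 64 8 * Real.exp (Real.exp (-(a / 20)) * 64)) ((c.L : ℝ) / 2) ∧
      0 ≤ a₂' ∧ kappa₀ 64 8 + a₂' ≤ c.δ * ((c.L : ℝ) / 2) * c.κ ∧ c.α₆ * Real.exp a₂' * K₀ 64 8 * 64 ≤ a₂' ∧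
      18 * ((1 - 7 * c.δ) * ((c.L : ℝ) / 2) * c.κ) ≤ (c.κ₁ - 1) / 2 ∧
      0 ≤ a₅ ∧ a₅ + Real.exp (-((c.κ₁ - 1) / 2)) ≤ Aabs ∧ Aabs * 64 ≤ c.δ * ((c.L : ℝ) / 2) * c.κ ∧
      B13Step237.bracketF c (K₀ 64 8 * Real.exp (Real.exp (-(a / 20)) * 64)) / c.α₆ * Real.exp (Aabs * 64) ≤
        c.C3act * c.ε₁ ∧
      0 ≤ c.C3act * c.ε₁ ∧ c.κ + 2 * (64 * Real.log 162) + 2 ≤ (1 - 8 * c.δ) * ((c.L : ℝ) / 2) * c.κ ∧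
      c.C3act * c.ε₁ * Real.exp (5 * c.κ + 1) * K₀ 64 8 * 9 * 64 ≤ 1 ∧
      Real.exp 1 * 9 * 64 * K₀ 64 8 ^ 2 ≤ c.A₂ ∧ c.R22 ∧ c.R23 ∧ c.R24sharp ∧ 0 ≤ c.E₀ ∧
      0 ≤ Bc ∧ Bc * 64 ≤ c.E₀ / 2 ∧
      0 < a₅ ∧ 1 ≤ c.κ₁ ∧
      (∀ d : ℝ, 0 ≤ d → 0 < invTau c d ∧ invTau c d ≤ 1 / 2) := by
  refine ⟨1, 1, 1 / 2, 1, 1 / 64, fun L hL => ?_⟩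
  have hLL : consts.L ≤ L := by rw [consts_L]; exact hL
  obtain ⟨c', hc'L, -, -, htr⟩ := lemma3_witness_transfer consts hLL
  refine ⟨c', hc'L, fun M hM => ?_⟩
  obtain ⟨a, h⟩ := allM_of_witness consts numerics_nonvacuous_pos_consts M hM
  exact htr h

end Summit.QuantumFields.BalabanUV.T4Continuum.Spine.NE5.TwoRunTorusNE5All8

end
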